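import Summits.QuantumFields.BalabanUV.Beta.EriceRemainderEnclosureHistoryAutonomyComparisonDualChainCriterion
import Summits.QuantumFields.BalabanUV.Beta.EriceRemainderEnclosureHistoryAutonomyComparisonChainFourAges

/-!
# EriceRemainderEnclosureHistoryAutonomyComparisonFourAges — (E68d) EVERY SET OF AT MOST FOUR AGES COMPARES AT ANY SIZE, WHATEVER THE RATIOS:
# `B(u) = b + Σ_{k<K} L_k·u_k` on ]0,γ] (`b > 0`, `L ≥ 0` supported on `{0} ∪ A`, `A ⊆ [1,K[`, **`#A ≤ 4`** — the ages, the sizes `L_k` AND the Markov weight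
# `L_0` ARBITRARY); `B′ ≥ B` with a zeroth moment and an ISOTONE excess ⟹ ANY box solutions from one pin satisfy `h′ ≤ h` at EVERY scale.  (E65f) with
# the chain of (E68c) ((E67e): three ages)

Cell `pub-balaban`, β-function sub-cell, BINDER row D4 «RemainderConst leaves for Bałaban's split» (`HOME/BINDER-OWNERS.md`; owner lineage `b2b-balaban-beta-an4`;
this file by co-owner #2 lineage `b2b-balaban-beta-d4-p2`, generation 59), β-FLOW TEAM duty (1), FREEZE (0) honoured (def-free; (E65f)'s
`le_of_isotone_excess_of_budgeted_dual_chain`, (E68c)'s `dual_chain_of_depth_le_three`, (E65b)'s `le_of_isotone_excess_budgeted_certificate` BY NAME;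
nothing restated).

HONEST FRAMING (page 1, verbatim and binding).  *"Discharging BetaPertH makes Bałaban's UV stability UNCONDITIONAL — a real constructive-QFT result; it is
NOT the continuum limit and NOT the Clay problem."*  THIS FILE DISCHARGES NOTHING OF THE KIND.  Elementary real analysis about ABSTRACT affine functionals on a
box ]0,γ]^ℕ with displayed supports and signs — hypotheses of a census, not facts; the form, signs, ages and moments of Bałaban's (1.22) limit functional are
NOT PRINTED ([I] p. 298; GAPS G-t4-U2-1∕-2) and NOT asserted.  Row D4 class UNCHANGED (critical-path width 0; instance 0∕1; D4 DISCHARGE NO DATE).  HONEST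
DEPENDENCY: continuum YM on T⁴ ⇐ BetaPertH ∧ nine spine estimates (0/9 proved); BetaPertH ⇐ (D1) ∧ (D4) ∧ CAP+tail; G-an2-4 gates asym, D1 and NE2/3/4.

THE POINT (census sense (α); the COMPARISON column, conjecture (E58′)).  Few-age ladder: one, two ((E6x) series), three ((E67e)), **four** (this file).  The
relaxation behind it (crude line + λ-route transport + envelopes `H₁`, `H₂`) fails at five ages (README `fourages.py`: condition `1.13`).  NOT CLAIMED: five
ages; anything printed.

WHAT IS PROVED ([folklore]; 0 `def`, 0 sorry).  **`le_of_isotone_excess_card_le_four`** (END, Finset form).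
-/
noncomputable section
open Finset Set

namespace Summit.QuantumFields.BalabanUV.Beta.EriceRemainderEnclosureHistoryAutonomyComparisonFourAges

open Literature.MathematicalPhysics.QuantumFieldTheory.Balaban1983to89
open Literature.MathematicalPhysics.QuantumFieldTheory.Balaban1983to89.T4BetaStationary
open Literature.MathematicalPhysics.QuantumFieldTheory.Balaban1983to89.T4BetaFlowWellPosed
open Summit.QuantumFields.BalabanUV.Beta.EriceRemainderEnclosureHistoryAutonomyComparisonBudgetedCriterion (le_of_isotone_excess_budgeted_certificate)
open Summit.QuantumFields.BalabanUV.Beta.EriceRemainderEnclosureHistoryAutonomyComparisonDualChainCriterion (le_of_isotone_excess_of_budgeted_dual_chain)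
open Summit.QuantumFields.BalabanUV.Beta.EriceRemainderEnclosureHistoryAutonomyComparisonChainFourAges (dual_chain_of_depth_le_three)

variable {B' : (ℕ → ℝ) → ℝ} {M' γ b : ℝ} {L : ℕ → ℝ} {K : ℕ} {A : Finset ℕ} {h h' : ℕ → ℝ}

/-! ## END: at most four ages, any ratios, any sizes -/

/-- **EVERY SET OF AT MOST FOUR AGES COMPARES AT ANY SIZE, WHATEVER THE RATIOS.**  `B(u) = b + Σ_{k<K} L_k·u_k` on ]0,γ] with `b > 0`, `L ≥ 0` supported on
`{0} ∪ A`, `A ⊆ [1, K[`, **`#A ≤ 4`** — the sizes `L_k` AND the Markov weight `L_0` ARBITRARY; `B′` with zeroth moment `M′ ≥ 0`, `B ≤ B′`, ISOTONE excess;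
`h`, `h′` ANY box solutions from one pin `p ∈ ]0,γ]`.  Then `h′ ≤ h` at EVERY scale ((E65f) with the chain of (E68c)). [folklore] -/
theorem le_of_isotone_excess_card_le_four {p : ℝ} (hL : ∀ k, 0 ≤ L k) (hb : 0 < b) (hAK : A ⊆ range K) (hA1 : ∀ k ∈ A, 1 ≤ k)
    (hsupp : ∀ k ∈ range K, k ∉ A → k ≠ 0 → L k = 0) (hcard : A.card ≤ 4)
    (hB' : ∀ u u' : ℕ → ℝ, SeqBox γ u → SeqBox γ u' → ∀ D : ℝ, (∀ j, |u j - u' j| ≤ D) → |B' u - B' u'| ≤ M' * D) (hM' : 0 ≤ M')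
    (hexc : ∀ u, SeqBox γ u → (fun u : ℕ → ℝ => b + ∑ k ∈ range K, L k * u k) u ≤ B' u)
    (hDmono : ∀ u v : ℕ → ℝ, SeqBox γ u → SeqBox γ v → (∀ j, u j ≤ v j) →
      B' u - (fun u : ℕ → ℝ => b + ∑ k ∈ range K, L k * u k) u ≤ B' v - (fun u : ℕ → ℝ => b + ∑ k ∈ range K, L k * u k) v)
    (hp : 0 < p) (hpγ : p ≤ γ) (hh : SeqBox γ h) (hf : MemFlow (fun u : ℕ → ℝ => b + ∑ k ∈ range K, L k * u k) p h)
    (hh' : SeqBox γ h') (hf' : MemFlow B' p h') (j : ℕ) : h' j ≤ h j := by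
  classical
  rcases A.eq_empty_or_nonempty with hA | hA
  · subst hA
    exact le_of_isotone_excess_budgeted_certificate hL hb hAK hA1 hsupp
      (fun x _ _ _ => ⟨fun _ => 0, fun _ h => absurd h (Finset.notMem_empty _), fun _ h => absurd h (Finset.notMem_empty _), by simp⟩)
      hB' hM' hexc hDmono hp hpγ hh hf hh' hf' j
  · set m₀ := A.min' hA with hm₀_def
    have hm₀ : m₀ ∈ A := min'_mem A hA
    have hmin : ∀ k ∈ A, m₀ ≤ k := fun k hk => min'_le A k hk
    set M₀ := A.max' hA with hM₀_def
    have hM₀ : M₀ ∈ A := max'_mem A hA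
    have hmax : ∀ k ∈ A, k ≤ M₀ := fun k hk => le_max' A k hk
    set pred : ℕ → ℕ := fun k => if hne : (A.filter (fun s => s < k)).Nonempty then (A.filter (fun s => s < k)).max' hne else 0
      with hpred_def
    have hpred : ∀ k ∈ A, k ≠ m₀ → pred k ∈ A ∧ pred k < k ∧ ∀ k'' ∈ A, k'' < k → k'' ≤ pred k := by
      intro k hk hkm
      have hlt : m₀ < k := lt_of_le_of_ne (hmin k hk) (Ne.symm hkm)
      have hne : (A.filter (fun s => s < k)).Nonempty := ⟨m₀, mem_filter.mpr ⟨hm₀, hlt⟩⟩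
      have hpk : pred k = (A.filter (fun s => s < k)).max' hne := by simp only [hpred_def, dif_pos hne]
      have hmem := max'_mem _ hne
      rw [← hpk] at hmem
      refine ⟨(mem_filter.mp hmem).1, (mem_filter.mp hmem).2, fun k'' hk'' hlt'' => ?_⟩
      rw [hpk]; exact le_max' _ _ (mem_filter.mpr ⟨hk'', hlt''⟩)
    have hdepth : ∀ k ∈ A, k ≠ m₀ → pred k ≠ m₀ → pred (pred k) ≠ m₀ → k = M₀ := by
      intro k hk hkm hpm hppm
      obtain ⟨hpA, hplt, _⟩ := hpred k hk hkm
      obtain ⟨hppA, hpplt, _⟩ := hpred (pred k) hpA hpm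
      have hm_lt : m₀ < pred (pred k) := lt_of_le_of_ne (hmin _ hppA) (Ne.symm hppm)
      by_contra hkM
      have hkM' : k < M₀ := lt_of_le_of_ne (hmax k hk) hkM
      have hsub : ({m₀, pred (pred k), pred k, k, M₀} : Finset ℕ) ⊆ A := by
        intro s hs
        simp only [Finset.mem_insert, Finset.mem_singleton] at hs
        rcases hs with rfl | rfl | rfl | rfl | rfl
        · exact hm₀
        · exact hppA
        · exact hpA
        · exact hk
        · exact hM₀
      have hc5 : ({m₀, pred (pred k), pred k, k, M₀} : Finset ℕ).card = 5 := by
        rw [Finset.card_insert_of_notMem (by simp; omega), Finset.card_insert_of_notMem (by simp; omega),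
          Finset.card_insert_of_notMem (by simp; omega), Finset.card_insert_of_notMem (by simp; omega), Finset.card_singleton]
      have := Finset.card_le_card hsub
      omega
    refine le_of_isotone_excess_of_budgeted_dual_chain hL hb hAK hA1 hsupp hm₀ hmin hpred (fun x hx _ hbud => ?_)
      hB' hM' hexc hDmono hp hpγ hh hf hh' hf' j
    exact dual_chain_of_depth_le_three hA1 hx hm₀ hmin hmax hpred hdepth (fun k hk => hbud k (hA1 k hk))

end Summit.QuantumFields.BalabanUV.Beta.EriceRemainderEnclosureHistoryAutonomyComparisonFourAges

end
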